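import Literature.NumberTheory.Sieve.LargeSieveCharacters
import HarnessLib

/-!
# The numerically explicit Pólya–Vinogradov inequality of Frolenkov–Soundararajan in Lapkova's form
# (Lapkova 2018, Lemma 3A) — AS PRINTED

Topic `Literature/NumberTheory/LFunctions` (namespace `Literature.NumberTheory.LFunctions`).
STATEMENT LAYER (D-0014), typed for the explicit `L(1, χ)` / exceptional-zero line of the cells
`parity-realchar` and `landau-siegel` (the explicit inputs behind `ExplicitLOneUpperBounds.lean`:
Johnston–Ramaré–Trudgian 2023 Lemma 13 is exactly this statement; Morrill–Trudgian 2020 and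
Bennett–Martin–O'Bryant–Rechnitzer use the same Frolenkov–Soundararajan constants). Companion of the
tree's PROVED `Literature.NumberTheory.Sieve.LargeSieve.polyaVinogradov`
(`|∑_{A<n≤A+N} χ(n)| ≤ √q (1 + log q)`, every primitive `χ` mod `q ≥ 2`): the fact below has the leading
constants `2/π² = 0.2026…` (even) and `1/(2π) = 0.1591…` (odd) instead of `1`.

Source: K. Lapkova, *Correction to: Explicit upper bound for the average number of divisors of
irreducible quadratic polynomials*, Monatsh. Math. **186** (2018) 675–678 [Lapkova2018PVCorrection]
(held text, read in full): "The following numerically explicit Pólya–Vinogradov inequality is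
essentially proven by Frolenkov and Soundararajan [1], though it was not formulated explicitly. It
supersedes the main result of Pomerance [5] … **Lemma 3A.** Let `M_χ := max_{L,P} |∑_{n=L}^{P} χ(n)|`
for a primitive character `χ` to the modulus `q > 1`. Then
`M_χ ≤ (2/π²) q^{1/2} log q + 0.9467 q^{1/2} + 1.668` (`χ` even);
`M_χ ≤ (1/(2π)) q^{1/2} log q + 0.8204 q^{1/2} + 1.0285` (`χ` odd).
*Proof.* Both inequalities for `M_χ` are shown to hold by Frolenkov and Soundararajan in the course of
the proof of their Theorem 2 [1] as long as … Thus both inequalities hold when `q > 25`. Then we have a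
look of the maximal possible values of `M_χ` when `q ≤ 25` from a data sheet, provided by Leo Goldmakher
…" (the same Lemma 3 appears in the original article, arXiv:1704.02498 §3). D. A. Frolenkov,
K. Soundararajan, *A generalization of the Pólya–Vinogradov inequality*, Ramanujan J. 31 (2013)
271–279 [FrolenkovSoundararajan2013], Theorem 2 (the proof the constants come from; not held).
Johnston–Ramaré–Trudgian 2023 (Res. Number Theory 9, Lemma 13) quote it with `1.0286` in place of
`1.0285` (weaker); the printed `1.0285` is typed.

## How it is typed

"primitive character to the modulus `q > 1`" = `χ : DirichletCharacter ℂ q`, `χ.IsPrimitive`,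
`1 < q`; `∑_{n=L}^{P} χ(n)` = `∑ n ∈ Finset.Icc L P, χ n` over natural numbers `L ≤ P` (all `L, P`;
an empty range gives `0`); parity = `χ.Even` / `χ.Odd`.

## Contents

* `lapkova2018_lemma3A` — NAMED FACT (as printed, both parities).
* PROVED readings: `Lapkova2018.norm_sum_Icc_le` (parity-free: the even constants dominate),
  `Lapkova2018.norm_sum_Ioc_le` (the window shape `∑_{A<n≤A+N}` of the tree's `polyaVinogradov`).

LABEL (cell rule): instrument / statement layer; explicit printed constants (partly by a finite
computation for `q ≤ 25`), not re-proved; no compute here.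

## References

* [Lapkova2018PVCorrection] Lemma 3A p. 677 (and arXiv:1704.02498, Lemma 3).
* [FrolenkovSoundararajan2013] Theorem 2 (proof).
* [JohnstonRamareTrudgian2023] Lemma 13 (consumer; quotes the statement).
-/

noncomputable section

open Complex Finset

namespace Literature.NumberTheory.LFunctions

/-- **Lapkova 2018, Lemma 3A — the explicit Pólya–Vinogradov inequality of Frolenkov–Soundararajan
(NAMED FACT, as printed).** For a primitive character `χ` mod `q > 1` and all `L, P`:
`|∑_{n=L}^{P} χ(n)| ≤ (2/π²)√q log q + 0.9467 √q + 1.668` if `χ` is even, and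
`≤ (1/(2π))√q log q + 0.8204 √q + 1.0285` if `χ` is odd. Unproved here.
[cite: Lapkova2018PVCorrection, Lemma 3A] [cite: FrolenkovSoundararajan2013, Theorem 2] -/
def lapkova2018_lemma3A : Prop :=
  ∀ (q : ℕ) [NeZero q] (χ : DirichletCharacter ℂ q), χ.IsPrimitive → 1 < q → ∀ L P : ℕ,
    (χ.Even → ‖∑ n ∈ Icc L P, χ n‖ ≤
      2 / Real.pi ^ 2 * Real.sqrt q * Real.log q + 0.9467 * Real.sqrt q + 1.668) ∧
    (χ.Odd → ‖∑ n ∈ Icc L P, χ n‖ ≤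
      1 / (2 * Real.pi) * Real.sqrt q * Real.log q + 0.8204 * Real.sqrt q + 1.0285)

namespace Lapkova2018

/-- **Parity-free reading**: `|∑_{n=L}^{P} χ(n)| ≤ (2/π²)√q log q + 0.9467 √q + 1.668` for every
primitive `χ` mod `q > 1` (`1/(2π) < 2/π²` since `π < 4`, `0.8204 < 0.9467`, `1.0285 < 1.668`).
[cite: Lapkova2018PVCorrection, Lemma 3A] -/
theorem norm_sum_Icc_le (h : lapkova2018_lemma3A) {q : ℕ} [NeZero q] (χ : DirichletCharacter ℂ q)
    (hprim : χ.IsPrimitive) (hq : 1 < q) (L P : ℕ) :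
    ‖∑ n ∈ Icc L P, χ n‖ ≤
      2 / Real.pi ^ 2 * Real.sqrt q * Real.log q + 0.9467 * Real.sqrt q + 1.668 := by
  obtain ⟨heven, hodd⟩ := h q χ hprim hq L P
  rcases χ.even_or_odd with he | ho
  · exact heven he
  · have hb := hodd ho
    have hπ := Real.pi_pos
    have hπ4 : Real.pi < 4 := by linarith [Real.pi_lt_d2]
    have hsq : 0 ≤ Real.sqrt (q : ℝ) := Real.sqrt_nonneg _
    have hlog : 0 ≤ Real.log (q : ℝ) := Real.log_nonneg (by exact_mod_cast hq.le)
    -- `1/(2π) ≤ 2/π²` ⟸ `π ≤ 4`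
    have hc : 1 / (2 * Real.pi) ≤ 2 / Real.pi ^ 2 := by
      rw [div_le_div_iff₀ (by positivity) (by positivity)]
      nlinarith
    have hmain : 1 / (2 * Real.pi) * Real.sqrt q * Real.log q ≤
        2 / Real.pi ^ 2 * Real.sqrt q * Real.log q := by
      have := mul_le_mul_of_nonneg_right (mul_le_mul_of_nonneg_right hc hsq) hlog
      exact this
    nlinarith

/-- **The window shape of the tree's `polyaVinogradov`**: for a primitive `χ` mod `q > 1`,
`|∑_{A<n≤A+N} χ(n)| ≤ (2/π²)√q log q + 0.9467 √q + 1.668` (compare `√q (1 + log q)`, PROVED in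
`LargeSieveCharacters.lean`). [cite: Lapkova2018PVCorrection, Lemma 3A] -/
theorem norm_sum_Ioc_le (h : lapkova2018_lemma3A) {q : ℕ} [NeZero q] (χ : DirichletCharacter ℂ q)
    (hprim : χ.IsPrimitive) (hq : 1 < q) (A N : ℕ) :
    ‖∑ n ∈ Ioc A (A + N), χ n‖ ≤
      2 / Real.pi ^ 2 * Real.sqrt q * Real.log q + 0.9467 * Real.sqrt q + 1.668 := by
  rw [← Finset.Icc_add_one_left_eq_Ioc]
  exact norm_sum_Icc_le h χ hprim hq (A + 1) (A + N)

end Lapkova2018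

end Literature.NumberTheory.LFunctions

end
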